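import Mathlib
import HarnessLib
import Summits.NavierStokesRegularity.NavierStokesRegularity.Theorems.UnthreadedRigidityDoorUnthreadedRigidityProfileHornRadial

/-!
# Route `UnthreadedRigidityDoor`, item `UnthreadedRigidity` (W2, stmt-NavierStokesRegularity-27585) — LINE g10-2 «PROFILE HORN»:
# THEOREM PHR, file 2/3 — the pressure moments, the bracket formula (★), the onset radius

Prover file (W2 Lean hand ns-crc-p1 g7, keyed by DIRECTOR-NS dss_128 / KEY-NS #184; `--supports stmt-NavierStokesRegularity-27585 --as helper`)
for LINE g10-2 «PROFILE HORN» of planner ns-idea-6 g10 on the wall item `UnthreadedRigidity` (route `UnthreadedRigidityDoor`, W2;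
idea-crit-4 g6 PASS 2026-08-29T01:30:55Z; sketch `pub/ideators/ns-idea-6/lines/UnthreadedRigidityDoor/ProfileHorn_sketch.lean` sha16
916bdf9b3eac7d48; objects and statements BY NAME in `Theorems/UnthreadedRigidityDoorUnthreadedRigidityProfileHornDefs.lean`).

Part C: integrability on `(a,∞)` of `ρa₂`, `ρa₄`, `ρh′(ρ²)²`; LEMMA J2 integrated `J₂(r) = ∫_(r,∞) ρa₂ = (12/7)G₂(r)` and LEMMA J4
integrated `J₄(r) = −8F₄(r) + 480∫_(r,∞) ρh′(ρ²)²` (FTC on `(r,∞)`, the boundary terms vanish by decay); the inner/outer moments of the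
tree (`innerMoment`, `outerMoment`) equal the model integrals; THE BRACKET FORMULA (★) on `(0,∞)`:
`W̃ = 16α² + (12/5)r⁻⁵I₂ − (96/35)G₂ − (80/63)r²r⁻⁹I₄ − (512/63)r²F₄ + (10240/21)r²∫_(r,∞)ρh′(ρ²)²`.
Part D: the onset structure — `(ρ⁶H′)′ = ρ⁶K` (`(2ρ⁷h′(ρ²))′ = ρ⁶(14h′ + 4ρ²h″)`), so `K = 0` on `(0,r₀)` and smoothness at the apex force
`h′(ρ²) = 0` on `(0,r₀]`, `h(ρ²) = h(0)` on `[0,r₀]`, `h″(ρ²) = 0` on `(0,r₀)`; positivity `∫_(a,∞)ρh′(ρ²)² = 0 ⇒ h′(ρ²) = 0` beyond `a`;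
CONTINUITY of `W̃` on `(0,∞)`; and the bracket AT A POSITIVE ONSET RADIUS: `W̃(r₀) = 144h₀² + (288/7)h₀² + (10240/21)r₀²∫_(r₀,∞)ρh′(ρ²)²`
(`108 − 27 = 81 > 0` of the paper, in the units `W̃ = (16/7)·(PH″)`).

HONEST LABEL: one-dimensional real analysis about the radial profile of SPECIAL (separable `l = 2`) slice data; it is a piece of a LINE on
the wall item, not the item: `UnthreadedRigidity` (27585), W2 and NS regularity remain OPEN; nothing here is a statement about the
Navier–Stokes equations.  0 kit.
-/

-- the summit and its single sub-problem share the name (CONVENTIONS §1), as in every Theorems file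
set_option linter.dupNamespace false

namespace Summit.NavierStokesRegularity.NavierStokesRegularity.Theorems.UnthreadedRigidity.ProfileHorn

open scoped Topology
open Filter Set MeasureTheory

/-! ## Part C — integrability, the outer moments `J₂ = (12/7) G₂`, `J₄ = −8 F₄ + 480 ∫ ρ h′(ρ²)²`, and the bracket formula -/

section Moments

open scoped ContDiff

variable {h H : ℝ → ℝ} {C : ℝ}

/-- A continuous function with `O(ρ⁻²)` decay is integrable on every `(a, ∞)`. -/
theorem integrableOn_Ioi_of_decay {f : ℝ → ℝ} {a K : ℝ} (hf : Continuous f)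
    (hK : ∀ ρ, 1 ≤ ρ → |f ρ| ≤ K / ρ ^ 2) : IntegrableOn f (Ioi a) := by
  have h1 : IntegrableOn f (Icc a (max a 1)) := hf.continuousOn.integrableOn_Icc
  have hm : 0 < max a 1 := lt_of_lt_of_le one_pos (le_max_right a 1)
  have h2 : IntegrableOn f (Ioi (max a 1)) := by
    have hg : IntegrableOn (fun ρ : ℝ => K * ρ ^ (-2 : ℝ)) (Ioi (max a 1)) :=
      (integrableOn_Ioi_rpow_of_lt (by norm_num) hm).const_mul K
    refine Integrable.mono' hg hf.aestronglyMeasurable ?_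
    filter_upwards [ae_restrict_mem measurableSet_Ioi] with ρ hρ
    have hρ1 : 1 ≤ ρ := le_trans (le_max_right a 1) (le_of_lt hρ)
    have hρ0 : 0 < ρ := lt_of_lt_of_le one_pos hρ1
    rw [Real.norm_eq_abs, Real.rpow_neg hρ0.le, Real.rpow_two, ← div_eq_mul_inv]
    exact hK ρ hρ1
  refine (h1.union h2).mono_set fun x hx => ?_
  rcases le_or_gt x (max a 1) with hle | hlt
  · exact Or.inl ⟨le_of_lt hx, hle⟩
  · exact Or.inr hlt

/-- `c / ρ → 0` at `+∞`. -/
theorem tendsto_const_div_atTop (c : ℝ) : Tendsto (fun ρ : ℝ => c / ρ) atTop (𝓝 0) :=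
  tendsto_const_nhds.div_atTop tendsto_id

/-- integrability of `ρ · a₂` (model form) on every `(a, ∞)`. -/
theorem integrableOn_mul_aTwo_model (hh : ContDiff ℝ ∞ h) (hH : ∀ r, 0 ≤ r → H r = h (r ^ 2))
    (hC : ∀ r, 1 ≤ r → r ^ 5 * |H r| ≤ C ∧ r ^ 6 * |deriv H r| ≤ C ∧ r ^ 7 * |deriv (deriv H) r| ≤ C) {a : ℝ} :
    IntegrableOn (fun ρ => ρ * (24 / 7 * (4 * ρ ^ 2 * deriv h (ρ ^ 2) ^ 2 + 42 * h (ρ ^ 2) * deriv h (ρ ^ 2) + 12 * ρ ^ 2 * h (ρ ^ 2) * deriv (deriv h) (ρ ^ 2) - 8 * ρ ^ 4 * deriv h (ρ ^ 2) * deriv (deriv h) (ρ ^ 2)))) (Ioi a) := by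
  have hc0 := hh.continuous
  have hc1 := (smooth_deriv_of_smooth hh).continuous
  have hc2 := continuous_deriv_deriv_of_smooth hh
  refine integrableOn_Ioi_of_decay (K := 576 / 7 * C ^ 2) (by fun_prop) fun ρ hρ => ?_
  have hρ0 : 0 < ρ := lt_of_lt_of_le one_pos hρ
  rw [← aTwo_eq (differentiable_of_smooth hh) (differentiable_deriv_of_smooth hh) hH hρ0]
  exact abs_mul_aTwo_le hC hρ

/-- integrability of `ρ · a₄` (model form) on every `(a, ∞)`. -/
theorem integrableOn_mul_aFour_model (hh : ContDiff ℝ ∞ h) (hH : ∀ r, 0 ≤ r → H r = h (r ^ 2))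
    (hC : ∀ r, 1 ≤ r → r ^ 5 * |H r| ≤ C ∧ r ^ 6 * |deriv H r| ≤ C ∧ r ^ 7 * |deriv (deriv H) r| ≤ C) {a : ℝ} :
    IntegrableOn (fun ρ => ρ * (8 * (52 * deriv h (ρ ^ 2) ^ 2 - 12 * h (ρ ^ 2) * deriv (deriv h) (ρ ^ 2) + 8 * ρ ^ 2 * deriv h (ρ ^ 2) * deriv (deriv h) (ρ ^ 2)))) (Ioi a) := by
  have hc0 := hh.continuous
  have hc1 := (smooth_deriv_of_smooth hh).continuous
  have hc2 := continuous_deriv_deriv_of_smooth hh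
  refine integrableOn_Ioi_of_decay (K := 152 * C ^ 2) (by fun_prop) fun ρ hρ => ?_
  have hρ0 : 0 < ρ := lt_of_lt_of_le one_pos hρ
  rw [← aFour_eq (differentiable_of_smooth hh) (differentiable_deriv_of_smooth hh) hH hρ0]
  exact abs_mul_aFour_le hC hρ

/-- integrability of the enstrophy-type integrand `ρ h′(ρ²)² = H′(ρ)²/(4ρ)` on every `(a, ∞)`. -/
theorem integrableOn_P_model (hh : ContDiff ℝ ∞ h) (hH : ∀ r, 0 ≤ r → H r = h (r ^ 2))
    (hC : ∀ r, 1 ≤ r → r ^ 5 * |H r| ≤ C ∧ r ^ 6 * |deriv H r| ≤ C ∧ r ^ 7 * |deriv (deriv H) r| ≤ C) {a : ℝ} :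
    IntegrableOn (fun ρ => ρ * deriv h (ρ ^ 2) ^ 2) (Ioi a) := by
  have hc1 := (smooth_deriv_of_smooth hh).continuous
  refine integrableOn_Ioi_of_decay (K := C ^ 2) (by fun_prop) fun ρ hρ => ?_
  have hρ0 : 0 < ρ := lt_of_lt_of_le one_pos hρ
  have e : ρ * deriv h (ρ ^ 2) ^ 2 = deriv H ρ ^ 2 / (4 * ρ) := by
    rw [deriv_profile (differentiable_of_smooth hh) hH hρ0]
    field_simp
    ring
  rw [e]
  exact abs_P_le hC hρ

/-- `G₂ → 0` at `+∞` (model form). -/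
theorem tendsto_G2_model (hh : ContDiff ℝ ∞ h) (hH : ∀ r, 0 ≤ r → H r = h (r ^ 2))
    (hC : ∀ r, 1 ≤ r → r ^ 5 * |H r| ≤ C ∧ r ^ 6 * |deriv H r| ≤ C ∧ r ^ 7 * |deriv (deriv H) r| ≤ C) :
    Tendsto (fun ρ => -(12 / 7 : ℝ) * (4 * ρ ^ 4 * deriv h (ρ ^ 2) ^ 2 - 12 * ρ ^ 2 * h (ρ ^ 2) * deriv h (ρ ^ 2) - 15 * h (ρ ^ 2) ^ 2)) atTop (𝓝 0) := by
  have hd := differentiable_of_smooth hh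
  refine squeeze_zero_norm' ?_ ((tendsto_const_div_atTop (12 / 7 * (22 * C ^ 2))))
  filter_upwards [eventually_ge_atTop (1 : ℝ)] with ρ hρ
  have hρ0 : 0 < ρ := lt_of_lt_of_le one_pos hρ
  have e : (4 * ρ ^ 4 * deriv h (ρ ^ 2) ^ 2 - 12 * ρ ^ 2 * h (ρ ^ 2) * deriv h (ρ ^ 2) - 15 * h (ρ ^ 2) ^ 2) = ρ ^ 2 * deriv H ρ ^ 2 - 6 * ρ * H ρ * deriv H ρ - 15 * H ρ ^ 2 := by
    rw [deriv_profile hd hH hρ0, hH ρ hρ0.le]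
    ring
  rw [Real.norm_eq_abs, abs_mul, e, abs_neg, abs_of_pos (by norm_num : (0:ℝ) < 12 / 7)]
  calc 12 / 7 * |ρ ^ 2 * deriv H ρ ^ 2 - 6 * ρ * H ρ * deriv H ρ - 15 * H ρ ^ 2|
      ≤ 12 / 7 * (22 * C ^ 2 / ρ) := mul_le_mul_of_nonneg_left (abs_G2_le hC hρ) (by norm_num)
    _ = 12 / 7 * (22 * C ^ 2) / ρ := by ring

/-- `F₄ → 0` at `+∞` (model form). -/
theorem tendsto_F4_model (hh : ContDiff ℝ ∞ h) (hH : ∀ r, 0 ≤ r → H r = h (r ^ 2))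
    (hC : ∀ r, 1 ≤ r → r ^ 5 * |H r| ≤ C ∧ r ^ 6 * |deriv H r| ≤ C ∧ r ^ 7 * |deriv (deriv H) r| ≤ C) :
    Tendsto (fun ρ => (8 : ℝ) * (2 * ρ ^ 2 * deriv h (ρ ^ 2) ^ 2 - 6 * h (ρ ^ 2) * deriv h (ρ ^ 2))) atTop (𝓝 0) := by
  have hd := differentiable_of_smooth hh
  refine squeeze_zero_norm' ?_ ((tendsto_const_div_atTop (8 * (4 * C ^ 2))))
  filter_upwards [eventually_ge_atTop (1 : ℝ)] with ρ hρ
  have hρ0 : 0 < ρ := lt_of_lt_of_le one_pos hρ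
  have e : (2 * ρ ^ 2 * deriv h (ρ ^ 2) ^ 2 - 6 * h (ρ ^ 2) * deriv h (ρ ^ 2)) = deriv H ρ ^ 2 / 2 - 3 * H ρ * deriv H ρ / ρ := by
    rw [deriv_profile hd hH hρ0, hH ρ hρ0.le]
    field_simp
    ring
  rw [Real.norm_eq_abs, abs_mul, e, abs_of_pos (by norm_num : (0:ℝ) < 8)]
  calc 8 * |deriv H ρ ^ 2 / 2 - 3 * H ρ * deriv H ρ / ρ|
      ≤ 8 * (4 * C ^ 2 / ρ) := mul_le_mul_of_nonneg_left (abs_F4_le hC hρ) (by norm_num)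
    _ = 8 * (4 * C ^ 2) / ρ := by ring

/-- LEMMA J2 integrated: `∫_(r,∞) ρ a₂ = (12/7) G₂(r)` for every `r` (model form). -/
theorem integral_Ioi_mul_aTwo_model (hh : ContDiff ℝ ∞ h) (hH : ∀ r, 0 ≤ r → H r = h (r ^ 2))
    (hC : ∀ r, 1 ≤ r → r ^ 5 * |H r| ≤ C ∧ r ^ 6 * |deriv H r| ≤ C ∧ r ^ 7 * |deriv (deriv H) r| ≤ C) (r : ℝ) :
    ∫ ρ in Ioi r, ρ * (24 / 7 * (4 * ρ ^ 2 * deriv h (ρ ^ 2) ^ 2 + 42 * h (ρ ^ 2) * deriv h (ρ ^ 2) + 12 * ρ ^ 2 * h (ρ ^ 2) * deriv (deriv h) (ρ ^ 2) - 8 * ρ ^ 4 * deriv h (ρ ^ 2) * deriv (deriv h) (ρ ^ 2))) = 12 / 7 * (4 * r ^ 4 * deriv h (r ^ 2) ^ 2 - 12 * r ^ 2 * h (r ^ 2) * deriv h (r ^ 2) - 15 * h (r ^ 2) ^ 2) := by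
  have hd := differentiable_of_smooth hh
  have hd2 := differentiable_deriv_of_smooth hh
  have key := integral_Ioi_of_hasDerivAt_of_tendsto (a := r)
    (f := fun x => -(12 / 7 : ℝ) * (4 * x ^ 4 * deriv h (x ^ 2) ^ 2 - 12 * x ^ 2 * h (x ^ 2) * deriv h (x ^ 2) - 15 * h (x ^ 2) ^ 2))
    (hasDerivAt_G2 hd hd2 r).continuousAt.continuousWithinAt
    (fun x _ => hasDerivAt_G2 hd hd2 x) (integrableOn_mul_aTwo_model hh hH hC)
    (tendsto_G2_model hh hH hC)
  rw [key]
  ring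

/-- LEMMA J4 integrated: `∫_(r,∞) ρ a₄ = −8 F₄(r) + 480 ∫_(r,∞) ρ h′(ρ²)²` for every `r` (model form). -/
theorem integral_Ioi_mul_aFour_model (hh : ContDiff ℝ ∞ h) (hH : ∀ r, 0 ≤ r → H r = h (r ^ 2))
    (hC : ∀ r, 1 ≤ r → r ^ 5 * |H r| ≤ C ∧ r ^ 6 * |deriv H r| ≤ C ∧ r ^ 7 * |deriv (deriv H) r| ≤ C) (r : ℝ) :
    ∫ ρ in Ioi r, ρ * (8 * (52 * deriv h (ρ ^ 2) ^ 2 - 12 * h (ρ ^ 2) * deriv (deriv h) (ρ ^ 2) + 8 * ρ ^ 2 * deriv h (ρ ^ 2) * deriv (deriv h) (ρ ^ 2)))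
      = -8 * (2 * r ^ 2 * deriv h (r ^ 2) ^ 2 - 6 * h (r ^ 2) * deriv h (r ^ 2)) + 480 * ∫ ρ in Ioi r, ρ * deriv h (ρ ^ 2) ^ 2 := by
  have hd := differentiable_of_smooth hh
  have hd2 := differentiable_deriv_of_smooth hh
  have hi4 := integrableOn_mul_aFour_model (a := r) hh hH hC
  have hiP := integrableOn_P_model (a := r) hh hH hC
  have hint : IntegrableOn (fun ρ => ρ * (8 * (52 * deriv h (ρ ^ 2) ^ 2 - 12 * h (ρ ^ 2) * deriv (deriv h) (ρ ^ 2) + 8 * ρ ^ 2 * deriv h (ρ ^ 2) * deriv (deriv h) (ρ ^ 2))) - 480 * (ρ * deriv h (ρ ^ 2) ^ 2)) (Ioi r) :=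
    hi4.sub (hiP.const_mul 480)
  have key := integral_Ioi_of_hasDerivAt_of_tendsto (a := r)
    (f := fun x => (8 : ℝ) * (2 * x ^ 2 * deriv h (x ^ 2) ^ 2 - 6 * h (x ^ 2) * deriv h (x ^ 2)))
    (hasDerivAt_F4 hd hd2 r).continuousAt.continuousWithinAt
    (fun x _ => hasDerivAt_F4 hd hd2 x) hint (tendsto_F4_model hh hH hC)
  have hsplit : ∫ ρ in Ioi r, (ρ * (8 * (52 * deriv h (ρ ^ 2) ^ 2 - 12 * h (ρ ^ 2) * deriv (deriv h) (ρ ^ 2) + 8 * ρ ^ 2 * deriv h (ρ ^ 2) * deriv (deriv h) (ρ ^ 2))) - 480 * (ρ * deriv h (ρ ^ 2) ^ 2))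
      = (∫ ρ in Ioi r, ρ * (8 * (52 * deriv h (ρ ^ 2) ^ 2 - 12 * h (ρ ^ 2) * deriv (deriv h) (ρ ^ 2) + 8 * ρ ^ 2 * deriv h (ρ ^ 2) * deriv (deriv h) (ρ ^ 2)))) - 480 * ∫ ρ in Ioi r, ρ * deriv h (ρ ^ 2) ^ 2 := by
    rw [integral_sub hi4 (hiP.const_mul 480), integral_const_mul]
  rw [hsplit] at key
  linarith

/-- the outer quadrupole moment of the profile equals the model integral (`r ≥ 0`). -/
theorem outerMoment_aTwo_eq (hh : ContDiff ℝ ∞ h) (hH : ∀ r, 0 ≤ r → H r = h (r ^ 2)) {r : ℝ} (hr : 0 ≤ r) :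
    outerMoment (aTwo H) r = ∫ ρ in Ioi r, ρ * (24 / 7 * (4 * ρ ^ 2 * deriv h (ρ ^ 2) ^ 2 + 42 * h (ρ ^ 2) * deriv h (ρ ^ 2) + 12 * ρ ^ 2 * h (ρ ^ 2) * deriv (deriv h) (ρ ^ 2) - 8 * ρ ^ 4 * deriv h (ρ ^ 2) * deriv (deriv h) (ρ ^ 2))) := by
  unfold outerMoment
  refine setIntegral_congr_fun measurableSet_Ioi fun ρ hρ => ?_
  have hρ0 : 0 < ρ := lt_of_le_of_lt hr hρ
  rw [aTwo_eq (differentiable_of_smooth hh) (differentiable_deriv_of_smooth hh) hH hρ0]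

/-- the outer hexadecapole moment of the profile equals the model integral (`r ≥ 0`). -/
theorem outerMoment_aFour_eq (hh : ContDiff ℝ ∞ h) (hH : ∀ r, 0 ≤ r → H r = h (r ^ 2)) {r : ℝ} (hr : 0 ≤ r) :
    outerMoment (aFour H) r = ∫ ρ in Ioi r, ρ * (8 * (52 * deriv h (ρ ^ 2) ^ 2 - 12 * h (ρ ^ 2) * deriv (deriv h) (ρ ^ 2) + 8 * ρ ^ 2 * deriv h (ρ ^ 2) * deriv (deriv h) (ρ ^ 2))) := by
  unfold outerMoment
  refine setIntegral_congr_fun measurableSet_Ioi fun ρ hρ => ?_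
  have hρ0 : 0 < ρ := lt_of_le_of_lt hr hρ
  rw [aFour_eq (differentiable_of_smooth hh) (differentiable_deriv_of_smooth hh) hH hρ0]

/-- the inner quadrupole moment of the profile equals the model interval integral (`r ≥ 0`). -/
theorem innerMoment_aTwo_eq (hh : ContDiff ℝ ∞ h) (hH : ∀ r, 0 ≤ r → H r = h (r ^ 2)) {r : ℝ} (hr : 0 ≤ r) :
    innerMoment (aTwo H) 2 r = ∫ ρ in (0:ℝ)..r, ρ ^ 6 * (24 / 7 * (4 * ρ ^ 2 * deriv h (ρ ^ 2) ^ 2 + 42 * h (ρ ^ 2) * deriv h (ρ ^ 2) + 12 * ρ ^ 2 * h (ρ ^ 2) * deriv (deriv h) (ρ ^ 2) - 8 * ρ ^ 4 * deriv h (ρ ^ 2) * deriv (deriv h) (ρ ^ 2))) := by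
  unfold innerMoment
  refine intervalIntegral.integral_congr fun ρ hρ => ?_
  rw [uIcc_of_le hr] at hρ
  rcases hρ.1.eq_or_lt with h0 | hpos
  · rw [← h0]; norm_num
  · rw [aTwo_eq (differentiable_of_smooth hh) (differentiable_deriv_of_smooth hh) hH hpos]

/-- the inner hexadecapole moment of the profile equals the model interval integral (`r ≥ 0`). -/
theorem innerMoment_aFour_eq (hh : ContDiff ℝ ∞ h) (hH : ∀ r, 0 ≤ r → H r = h (r ^ 2)) {r : ℝ} (hr : 0 ≤ r) :
    innerMoment (aFour H) 4 r = ∫ ρ in (0:ℝ)..r, ρ ^ 10 * (8 * (52 * deriv h (ρ ^ 2) ^ 2 - 12 * h (ρ ^ 2) * deriv (deriv h) (ρ ^ 2) + 8 * ρ ^ 2 * deriv h (ρ ^ 2) * deriv (deriv h) (ρ ^ 2))) := by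
  unfold innerMoment
  refine intervalIntegral.integral_congr fun ρ hρ => ?_
  rw [uIcc_of_le hr] at hρ
  rcases hρ.1.eq_or_lt with h0 | hpos
  · rw [← h0]; norm_num
  · rw [aFour_eq (differentiable_of_smooth hh) (differentiable_deriv_of_smooth hh) hH hpos]

/-- THE BRACKET FORMULA (★): for `r > 0`,
`W̃[H](r) = 16 α² + (12/5) r⁻⁵ I₂ − (96/35) G₂ − (80/63) r² r⁻⁹ I₄ − (512/63) r² F₄ + (10240/21) r² ∫_(r,∞) ρ h′(ρ²)²`
with every quantity in model form (`I₂ = ∫₀ʳ ρ⁶ a₂`, `I₄ = ∫₀ʳ ρ¹⁰ a₄`). -/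
theorem hornBracket_eq (hh : ContDiff ℝ ∞ h) (hH : ∀ r, 0 ≤ r → H r = h (r ^ 2))
    (hC : ∀ r, 1 ≤ r → r ^ 5 * |H r| ≤ C ∧ r ^ 6 * |deriv H r| ≤ C ∧ r ^ 7 * |deriv (deriv H) r| ≤ C) {r : ℝ} (hr : 0 < r) :
    hornBracket H r = 16 * (2 * r ^ 2 * deriv h (r ^ 2) + 3 * h (r ^ 2)) ^ 2
      + 12 / 5 * (r ^ 5)⁻¹ * (∫ ρ in (0:ℝ)..r, ρ ^ 6 * (24 / 7 * (4 * ρ ^ 2 * deriv h (ρ ^ 2) ^ 2 + 42 * h (ρ ^ 2) * deriv h (ρ ^ 2) + 12 * ρ ^ 2 * h (ρ ^ 2) * deriv (deriv h) (ρ ^ 2) - 8 * ρ ^ 4 * deriv h (ρ ^ 2) * deriv (deriv h) (ρ ^ 2))))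
      - 96 / 35 * (4 * r ^ 4 * deriv h (r ^ 2) ^ 2 - 12 * r ^ 2 * h (r ^ 2) * deriv h (r ^ 2) - 15 * h (r ^ 2) ^ 2)
      - 80 / 63 * r ^ 2 * (r ^ 9)⁻¹ * (∫ ρ in (0:ℝ)..r, ρ ^ 10 * (8 * (52 * deriv h (ρ ^ 2) ^ 2 - 12 * h (ρ ^ 2) * deriv (deriv h) (ρ ^ 2) + 8 * ρ ^ 2 * deriv h (ρ ^ 2) * deriv (deriv h) (ρ ^ 2))))
      - 512 / 63 * r ^ 2 * (2 * r ^ 2 * deriv h (r ^ 2) ^ 2 - 6 * h (r ^ 2) * deriv h (r ^ 2))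
      + 10240 / 21 * r ^ 2 * ∫ ρ in Ioi r, ρ * deriv h (ρ ^ 2) ^ 2 := by
  unfold hornBracket eulerPressure
  rw [strainAmp_eq (differentiable_of_smooth hh) hH hr, innerMoment_aTwo_eq hh hH hr.le,
    innerMoment_aFour_eq hh hH hr.le, outerMoment_aTwo_eq hh hH hr.le, outerMoment_aFour_eq hh hH hr.le,
    integral_Ioi_mul_aTwo_model hh hH hC r, integral_Ioi_mul_aFour_model hh hH hC r]
  push_cast
  ring

end Moments

/-! ## Part D — the onset radius: structure below `r₀`, continuity of the bracket, the case `r₀ > 0` -/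

section Onset

open scoped ContDiff

variable {h H : ℝ → ℝ} {C : ℝ}

/-- `(ρ⁶ H′)′ = ρ⁶ K` in the variable `ρ`: `d/dρ (2ρ⁷ h′(ρ²)) = ρ⁶ (14 h′(ρ²) + 4ρ² h″(ρ²))`. -/
theorem hasDerivAt_flux (hh : ContDiff ℝ ∞ h) (ρ : ℝ) :
    HasDerivAt (fun x => 2 * x ^ 7 * deriv h (x ^ 2)) (ρ ^ 6 * (14 * deriv h (ρ ^ 2) + 4 * ρ ^ 2 * deriv (deriv h) (ρ ^ 2))) ρ := by
  have hd2 := differentiable_deriv_of_smooth hh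
  have e1 : HasDerivAt (fun x => deriv h (x ^ 2)) (2 * ρ * deriv (deriv h) (ρ ^ 2)) ρ := hasDerivAt_comp_sq hd2 ρ
  have e7 : HasDerivAt (fun x : ℝ => x ^ 7) (7 * ρ ^ 6) ρ := by simpa using hasDerivAt_pow 7 ρ
  have key := (e7.const_mul (2 : ℝ)).fun_mul e1
  refine (key.congr_of_eventuallyEq (Eventually.of_forall fun x => rfl)).congr_deriv ?_
  ring

/-- BELOW THE ONSET RADIUS the profile is flat: if `K = 0` on `(0, r₀)` then `h′(ρ²) = 0` for `ρ ∈ (0, r₀]`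
(the `ρ⁻⁵` branch of `(ρ⁶H′)′ = 0` is killed by smoothness at the apex: the flux `2ρ⁷h′(ρ²)` vanishes at `ρ = 0`). -/
theorem deriv_eq_zero_below (hh : ContDiff ℝ ∞ h) {r₀ : ℝ}
    (hK : ∀ ρ ∈ Ioo 0 r₀, (14 * deriv h (ρ ^ 2) + 4 * ρ ^ 2 * deriv (deriv h) (ρ ^ 2)) = 0) :
    ∀ ρ ∈ Ioc 0 r₀, deriv h (ρ ^ 2) = 0 := by
  intro ρ hρ
  have hcont : ContinuousOn (fun x => 2 * x ^ 7 * deriv h (x ^ 2)) (Icc 0 r₀) := by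
    have hc1 := (smooth_deriv_of_smooth hh).continuous
    exact (by fun_prop : Continuous fun x => 2 * x ^ 7 * deriv h (x ^ 2)).continuousOn
  have hder : ∀ x ∈ Ico 0 r₀, HasDerivWithinAt (fun x => 2 * x ^ 7 * deriv h (x ^ 2)) 0 (Ici x) x := by
    intro x hx
    have hfx := hasDerivAt_flux hh x
    rcases hx.1.eq_or_lt with h0 | hpos
    · rw [← h0] at hfx ⊢
      simpa using hfx.hasDerivWithinAt
    · rw [hK x ⟨hpos, hx.2⟩, mul_zero] at hfx
      exact hfx.hasDerivWithinAt
  have hflat := constant_of_has_deriv_right_zero hcont hder ρ ⟨hρ.1.le, hρ.2⟩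
  have hρ0 : 0 < ρ := hρ.1
  have h7 : (2 : ℝ) * ρ ^ 7 ≠ 0 := by positivity
  have : 2 * ρ ^ 7 * deriv h (ρ ^ 2) = 0 := by simpa using hflat
  exact (mul_eq_zero.mp this).resolve_left h7

/-- if `h′(ρ²) = 0` on `(0, R]` then `h(ρ²) = h(0)` on `[0, R]`. -/
theorem profile_const_of_deriv_eq_zero (hh : ContDiff ℝ ∞ h) {R : ℝ}
    (hz : ∀ ρ ∈ Ioc 0 R, deriv h (ρ ^ 2) = 0) : ∀ ρ ∈ Icc 0 R, h (ρ ^ 2) = h 0 := by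
  have hd := differentiable_of_smooth hh
  have hcont : ContinuousOn (fun x => h (x ^ 2)) (Icc 0 R) := (continuous_comp_sq hh.continuous).continuousOn
  have hder : ∀ x ∈ Ico 0 R, HasDerivWithinAt (fun x => h (x ^ 2)) 0 (Ici x) x := by
    intro x hx
    have hfx := hasDerivAt_comp_sq hd x
    rcases hx.1.eq_or_lt with h0 | hpos
    · rw [← h0] at hfx ⊢
      simpa using hfx.hasDerivWithinAt
    · rw [hz x ⟨hpos, hx.2.le⟩, mul_zero] at hfx
      exact hfx.hasDerivWithinAt
  intro ρ hρ
  have := constant_of_has_deriv_right_zero hcont hder ρ hρ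
  simpa using this

/-- if `h′ = 0` on `(0, r₀²)` (as `h′(ρ²) = 0` for `ρ ∈ (0, r₀)`) then `h″(ρ²) = 0` for `ρ ∈ (0, r₀)`. -/
theorem deriv_deriv_eq_zero_below {r₀ : ℝ}
    (hz : ∀ ρ ∈ Ioo 0 r₀, deriv h (ρ ^ 2) = 0) : ∀ ρ ∈ Ioo 0 r₀, deriv (deriv h) (ρ ^ 2) = 0 := by
  intro ρ hρ
  have hev : deriv h =ᶠ[𝓝 (ρ ^ 2)] fun _ => (0 : ℝ) := by
    have hlo : Ioo (0 : ℝ) (r₀ ^ 2) ∈ 𝓝 (ρ ^ 2) :=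
      Ioo_mem_nhds (by nlinarith [hρ.1]) (by nlinarith [hρ.1, hρ.2])
    filter_upwards [hlo] with s hs
    have hs0 : 0 < s := hs.1
    have e : s = (Real.sqrt s) ^ 2 := (Real.sq_sqrt hs0.le).symm
    rw [e]
    refine hz (Real.sqrt s) ⟨Real.sqrt_pos.mpr hs0, ?_⟩
    have h1 : Real.sqrt s < Real.sqrt (r₀ ^ 2) := Real.sqrt_lt_sqrt hs0.le hs.2
    rwa [Real.sqrt_sq (le_of_lt (lt_trans hρ.1 hρ.2))] at h1
  rw [hev.deriv_eq, deriv_const]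

/-- POSITIVITY: if `∫_(a,∞) ρ h′(ρ²)² dρ = 0` (`a ≥ 0`) then `h′(ρ²) = 0` for every `ρ > a`. -/
theorem deriv_eq_zero_of_integral_eq_zero (hh : ContDiff ℝ ∞ h) {a : ℝ} (ha : 0 ≤ a)
    (hint : IntegrableOn (fun ρ => ρ * deriv h (ρ ^ 2) ^ 2) (Ioi a)) (h0 : ∫ ρ in Ioi a, ρ * deriv h (ρ ^ 2) ^ 2 = 0) :
    ∀ ρ, a < ρ → deriv h (ρ ^ 2) = 0 := by
  intro ρ₁ hρ₁
  by_contra hne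
  have hc1 := (smooth_deriv_of_smooth hh).continuous
  have hfc : Continuous fun ρ => ρ * deriv h (ρ ^ 2) ^ 2 := by fun_prop
  have hnn : 0 ≤ᵐ[volume.restrict (Ioi a)] fun ρ => ρ * deriv h (ρ ^ 2) ^ 2 := by
    filter_upwards [ae_restrict_mem measurableSet_Ioi] with ρ hρ
    exact mul_nonneg (le_of_lt (lt_of_le_of_lt ha hρ)) (sq_nonneg _)
  have hpos : 0 < ∫ ρ in Ioi a, ρ * deriv h (ρ ^ 2) ^ 2 := by
    rw [setIntegral_pos_iff_support_of_nonneg_ae hnn hint]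
    have hopen : IsOpen ({ρ : ℝ | ρ * deriv h (ρ ^ 2) ^ 2 ≠ 0} ∩ Ioi a) :=
      (isOpen_ne_fun hfc continuous_const).inter isOpen_Ioi
    have hmem : ρ₁ ∈ {ρ : ℝ | ρ * deriv h (ρ ^ 2) ^ 2 ≠ 0} ∩ Ioi a := by
      refine ⟨?_, hρ₁⟩
      have : 0 < ρ₁ := lt_of_le_of_lt ha hρ₁
      exact mul_ne_zero (ne_of_gt this) (pow_ne_zero 2 hne)
    exact hopen.measure_pos volume ⟨ρ₁, hmem⟩
  exact (ne_of_gt hpos) h0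

/-- CONTINUITY of the bracket on `(0, ∞)` (through the formula (★)). -/
theorem continuousOn_hornBracket (hh : ContDiff ℝ ∞ h) (hH : ∀ r, 0 ≤ r → H r = h (r ^ 2))
    (hC : ∀ r, 1 ≤ r → r ^ 5 * |H r| ≤ C ∧ r ^ 6 * |deriv H r| ≤ C ∧ r ^ 7 * |deriv (deriv H) r| ≤ C) : ContinuousOn (hornBracket H) (Ioi 0) := by
  have hc0 := hh.continuous
  have hc1 := (smooth_deriv_of_smooth hh).continuous
  have hc2 := continuous_deriv_deriv_of_smooth hh
  have hI2 : Continuous fun r => ∫ ρ in (0:ℝ)..r, ρ ^ 6 * (24 / 7 * (4 * ρ ^ 2 * deriv h (ρ ^ 2) ^ 2 + 42 * h (ρ ^ 2) * deriv h (ρ ^ 2) + 12 * ρ ^ 2 * h (ρ ^ 2) * deriv (deriv h) (ρ ^ 2) - 8 * ρ ^ 4 * deriv h (ρ ^ 2) * deriv (deriv h) (ρ ^ 2))) :=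
    intervalIntegral.continuous_primitive (fun a b => (by fun_prop : Continuous fun ρ => ρ ^ 6 * (24 / 7 * (4 * ρ ^ 2 * deriv h (ρ ^ 2) ^ 2 + 42 * h (ρ ^ 2) * deriv h (ρ ^ 2) + 12 * ρ ^ 2 * h (ρ ^ 2) * deriv (deriv h) (ρ ^ 2) - 8 * ρ ^ 4 * deriv h (ρ ^ 2) * deriv (deriv h) (ρ ^ 2)))).intervalIntegrable a b) 0
  have hI4 : Continuous fun r => ∫ ρ in (0:ℝ)..r, ρ ^ 10 * (8 * (52 * deriv h (ρ ^ 2) ^ 2 - 12 * h (ρ ^ 2) * deriv (deriv h) (ρ ^ 2) + 8 * ρ ^ 2 * deriv h (ρ ^ 2) * deriv (deriv h) (ρ ^ 2))) :=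
    intervalIntegral.continuous_primitive (fun a b => (by fun_prop : Continuous fun ρ => ρ ^ 10 * (8 * (52 * deriv h (ρ ^ 2) ^ 2 - 12 * h (ρ ^ 2) * deriv (deriv h) (ρ ^ 2) + 8 * ρ ^ 2 * deriv h (ρ ^ 2) * deriv (deriv h) (ρ ^ 2)))).intervalIntegrable a b) 0
  have hP0 := integrableOn_P_model (a := 0) hh hH hC
  have hPc : ContinuousOn (fun r => ∫ ρ in Ioi r, ρ * deriv h (ρ ^ 2) ^ 2) (Ioi 0) := by
    have hprim : Continuous fun r => ∫ ρ in (0:ℝ)..r, ρ * deriv h (ρ ^ 2) ^ 2 :=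
      intervalIntegral.continuous_primitive (fun a b => (by fun_prop : Continuous fun ρ => ρ * deriv h (ρ ^ 2) ^ 2).intervalIntegrable a b) 0
    have hg : Continuous fun r => (∫ ρ in Ioi 0, ρ * deriv h (ρ ^ 2) ^ 2) - ∫ ρ in (0:ℝ)..r, ρ * deriv h (ρ ^ 2) ^ 2 :=
      continuous_const.sub hprim
    refine hg.continuousOn.congr fun r hr => ?_
    show ∫ ρ in Ioi r, ρ * deriv h (ρ ^ 2) ^ 2 = (∫ ρ in Ioi 0, ρ * deriv h (ρ ^ 2) ^ 2) - ∫ ρ in (0:ℝ)..r, ρ * deriv h (ρ ^ 2) ^ 2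
    rw [← intervalIntegral.integral_Ioi_sub_Ioi hP0 (le_of_lt hr)]
    ring
  have hinv5 : ContinuousOn (fun r : ℝ => (r ^ 5)⁻¹) (Ioi 0) :=
    ((continuous_pow 5).continuousOn).inv₀ fun x hx => pow_ne_zero 5 (ne_of_gt hx)
  have hinv9 : ContinuousOn (fun r : ℝ => (r ^ 9)⁻¹) (Ioi 0) :=
    ((continuous_pow 9).continuousOn).inv₀ fun x hx => pow_ne_zero 9 (ne_of_gt hx)
  have t1 : Continuous fun r => 16 * (2 * r ^ 2 * deriv h (r ^ 2) + 3 * h (r ^ 2)) ^ 2 := by fun_prop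
  have t2 : ContinuousOn (fun r => 12 / 5 * (r ^ 5)⁻¹ * (∫ ρ in (0:ℝ)..r, ρ ^ 6 * (24 / 7 * (4 * ρ ^ 2 * deriv h (ρ ^ 2) ^ 2 + 42 * h (ρ ^ 2) * deriv h (ρ ^ 2) + 12 * ρ ^ 2 * h (ρ ^ 2) * deriv (deriv h) (ρ ^ 2) - 8 * ρ ^ 4 * deriv h (ρ ^ 2) * deriv (deriv h) (ρ ^ 2))))) (Ioi 0) :=
    (continuousOn_const.mul hinv5).mul hI2.continuousOn
  have t3 : Continuous fun r => 96 / 35 * (4 * r ^ 4 * deriv h (r ^ 2) ^ 2 - 12 * r ^ 2 * h (r ^ 2) * deriv h (r ^ 2) - 15 * h (r ^ 2) ^ 2) := by fun_prop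
  have t4 : ContinuousOn (fun r => 80 / 63 * r ^ 2 * (r ^ 9)⁻¹ * (∫ ρ in (0:ℝ)..r, ρ ^ 10 * (8 * (52 * deriv h (ρ ^ 2) ^ 2 - 12 * h (ρ ^ 2) * deriv (deriv h) (ρ ^ 2) + 8 * ρ ^ 2 * deriv h (ρ ^ 2) * deriv (deriv h) (ρ ^ 2))))) (Ioi 0) :=
    (((continuousOn_const.mul (continuous_pow 2).continuousOn).mul hinv9)).mul hI4.continuousOn
  have t5 : Continuous fun r => 512 / 63 * r ^ 2 * (2 * r ^ 2 * deriv h (r ^ 2) ^ 2 - 6 * h (r ^ 2) * deriv h (r ^ 2)) := by fun_prop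
  have t6 : ContinuousOn (fun r => 10240 / 21 * r ^ 2 * ∫ ρ in Ioi r, ρ * deriv h (ρ ^ 2) ^ 2) (Ioi 0) :=
    (continuousOn_const.mul (continuous_pow 2).continuousOn).mul hPc
  have hsum := ((((t1.continuousOn.add t2).sub t3.continuousOn).sub t4).sub t5.continuousOn).add t6
  exact hsum.congr fun r hr => hornBracket_eq hh hH hC hr

/-- THE BRACKET AT A POSITIVE ONSET RADIUS: if `K = 0` on `(0, r₀)`, `r₀ > 0`, then
`W̃(r₀) = 144 h₀² + (288/7) h₀² + (10240/21) r₀² ∫_(r₀,∞) ρ h′(ρ²)²`, `h₀ = h(0)`. -/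
theorem hornBracket_onset (hh : ContDiff ℝ ∞ h) (hH : ∀ r, 0 ≤ r → H r = h (r ^ 2))
    (hC : ∀ r, 1 ≤ r → r ^ 5 * |H r| ≤ C ∧ r ^ 6 * |deriv H r| ≤ C ∧ r ^ 7 * |deriv (deriv H) r| ≤ C) {r₀ : ℝ} (hr₀ : 0 < r₀)
    (hK : ∀ ρ ∈ Ioo 0 r₀, (14 * deriv h (ρ ^ 2) + 4 * ρ ^ 2 * deriv (deriv h) (ρ ^ 2)) = 0) :
    hornBracket H r₀ = 144 * h 0 ^ 2 + 288 / 7 * h 0 ^ 2 + 10240 / 21 * r₀ ^ 2 * ∫ ρ in Ioi r₀, ρ * deriv h (ρ ^ 2) ^ 2 := by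
  have hz : ∀ ρ ∈ Ioc 0 r₀, deriv h (ρ ^ 2) = 0 := deriv_eq_zero_below hh hK
  have hz' : ∀ ρ ∈ Ioo 0 r₀, deriv h (ρ ^ 2) = 0 := fun ρ hρ => hz ρ ⟨hρ.1, hρ.2.le⟩
  have hzz : ∀ ρ ∈ Ioo 0 r₀, deriv (deriv h) (ρ ^ 2) = 0 := deriv_deriv_eq_zero_below hz'
  have hflat : ∀ ρ ∈ Icc 0 r₀, h (ρ ^ 2) = h 0 := profile_const_of_deriv_eq_zero hh hz
  have e1 : deriv h (r₀ ^ 2) = 0 := hz r₀ ⟨hr₀, le_rfl⟩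
  have e0 : h (r₀ ^ 2) = h 0 := hflat r₀ ⟨hr₀.le, le_rfl⟩
  have I2 : ∫ ρ in (0:ℝ)..r₀, ρ ^ 6 * (24 / 7 * (4 * ρ ^ 2 * deriv h (ρ ^ 2) ^ 2 + 42 * h (ρ ^ 2) * deriv h (ρ ^ 2) + 12 * ρ ^ 2 * h (ρ ^ 2) * deriv (deriv h) (ρ ^ 2) - 8 * ρ ^ 4 * deriv h (ρ ^ 2) * deriv (deriv h) (ρ ^ 2))) = 0 := by
    rw [intervalIntegral.integral_of_le hr₀.le, integral_Ioc_eq_integral_Ioo,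
      setIntegral_congr_fun measurableSet_Ioo (g := fun _ => (0:ℝ)) fun ρ hρ => ?_]
    · simp
    · simp only [hz' ρ hρ, hzz ρ hρ]; ring
  have I4 : ∫ ρ in (0:ℝ)..r₀, ρ ^ 10 * (8 * (52 * deriv h (ρ ^ 2) ^ 2 - 12 * h (ρ ^ 2) * deriv (deriv h) (ρ ^ 2) + 8 * ρ ^ 2 * deriv h (ρ ^ 2) * deriv (deriv h) (ρ ^ 2))) = 0 := by
    rw [intervalIntegral.integral_of_le hr₀.le, integral_Ioc_eq_integral_Ioo,
      setIntegral_congr_fun measurableSet_Ioo (g := fun _ => (0:ℝ)) fun ρ hρ => ?_]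
    · simp
    · simp only [hz' ρ hρ, hzz ρ hρ]; ring
  rw [hornBracket_eq hh hH hC hr₀, I2, I4, e1, e0]
  ring

end Onset

end Summit.NavierStokesRegularity.NavierStokesRegularity.Theorems.UnthreadedRigidity.ProfileHorn
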